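import Literature.AlgebraicGeometry.Morphisms.CompactificationBaseGluing
import Literature.AlgebraicGeometry.Morphisms.TwoPieceCompactification
import HarnessLib

/-!
# Nagata's compactification theorem from Raynaud–Gruson flattening

Topic: `Literature/AlgebraicGeometry/Morphisms`. The named fact `NagataCompactification`
(`NagataCompactification.lean`; Conrad 2007, Thm. 4.1 = The Stacks Project, Tag 0F41: "Let `S` be
a quasi-compact and quasi-separated scheme. Let `X → S` be a separated, finite type morphism.
Then `X` has a compactification over `S`") REDUCED TO the named fact `Resolution.Stacks081R`
(Raynaud–Gruson 1971, Première partie, Thm. 5.2.2 = Stacks, Tag 081R: flattening of the strict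
transform by a `U`-admissible blowing up), which is the only undischarged input:

* over the affine opens `U ⊆ S`: absolute Noetherian approximation over an affine base
  (`Limits.exists_finiteTypeModel`, Stacks 09ZP) reduces to a Noetherian total space over the
  Noetherian affine base `Spec A₀`, where the induction of Tag 0F41 over a dense affine open cover
  (`exists_compactification_of_isNoetherian_of_twoPiece`) applies, the affine pieces being
  compactified in `𝐏ⁿ` (`exists_compactification_of_isAffine`) and the two-piece step being
  Stacks 0F40 (`h0F40_of_stacks081R`, file `TwoPieceCompactification.lean`, from `Stacks081R`);
* the affine opens of `S` glue: compactifiability is Zariski-local on a quasi-compact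
  quasi-separated base granted `Stacks081R` (`exists_compactification_of_forall_affineOpens`,
  file `CompactificationBaseGluing.lean`: common admissible blowing ups of two compactifications,
  Conrad 2007, Remark 2.12 / Stacks 081T), which replaces the Noetherian approximation of general
  qcqs bases (Thomason–Trobaugh C.9) used by both printed proofs.

* `exists_compactification_affineBase_of_twoPiece_noetherian` — the affine-base case with the
  two-piece hypothesis only over affine NOETHERIAN bases and Noetherian total spaces (the form
  `h0F40_of_stacks081R` provides);
* `NagataCompactification.of_stacks081R` — **`Stacks081R → NagataCompactification`**.

When `Stacks081R` is discharged (`Stacks081R_holds`), `NagataCompactification_holds` is the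
one-liner `NagataCompactification.of_stacks081R Stacks081R_holds` (to be placed in a sibling
`NagataCompactificationProofs.lean`).

## References

* B. Conrad, *Deligne's notes on Nagata compactifications*, J. Ramanujan Math. Soc. 22 (2007),
  Thm. 4.1, Remark 2.12. [Conrad2007]
* The Stacks Project, Tags 0F41, 0F40, 081R, 081T, 09ZP. [StacksProject]
* M. Raynaud, L. Gruson, *Critères de platitude et de projectivité*, Invent. Math. 13 (1971),
  Première partie, Thm. 5.2.2. [RaynaudGruson1971]
-/

noncomputable section

-- Mathlib's pull-back API is stated through `abbrev`s over `limit`; as in Mathlib's own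
-- algebraic-geometry files we let `simp`/unification see through them.
set_option backward.isDefEq.respectTransparency false

open CategoryTheory CategoryTheory.Limits AlgebraicGeometry TopologicalSpace

namespace Literature.AlgebraicGeometry.Morphisms

universe u

open Literature.AlgebraicGeometry.Resolution

/-- `exists_compactification_affineBase_of_twoPiece` with the two-piece hypothesis (Stacks 0F40)
only required for Noetherian total spaces over affine NOETHERIAN bases (all its proof uses: the
Noetherian model lives over `Spec A₀` with `A₀` Noetherian): over an affine base `Spec B`, every
separated morphism of finite type is compactifiable, granted (a) compactifiability of affine
schemes of finite type and (b) this form of Stacks 0F40. Proof verbatim as there (Stacks 09ZP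
Noetherian model, the Noetherian case, base change, immersion).
[cite: StacksProject, Tag 0F41 (proof, reduction to the Noetherian case)] -/
theorem exists_compactification_affineBase_of_twoPiece_noetherian
    (hAff : ∀ ⦃S U : Scheme.{u}⦄ [IsAffine U] (g : U ⟶ S) [LocallyOfFiniteType g] [QuasiCompact g],
      ∃ (Uc : Scheme.{u}) (j : U ⟶ Uc) (h : Uc ⟶ S), IsOpenImmersion j ∧ IsProper h ∧ j ≫ h = g)
    (h0F40 : ∀ ⦃S X : Scheme.{u}⦄ [IsAffine S] [IsNoetherian S] [IsNoetherian X] (f : X ⟶ S)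
      [IsSeparated f] [LocallyOfFiniteType f] (W W₁ W₂ : X.Opens), W₁ ⊔ W₂ = W →
      Dense (W.ι ⁻¹' ((W₁ ⊓ W₂ : X.Opens) : Set X)) →
      (∃ (Wc : Scheme.{u}) (j : ↑W₁ ⟶ Wc) (h : Wc ⟶ S),
        IsOpenImmersion j ∧ IsProper h ∧ j ≫ h = W₁.ι ≫ f) →
      (∃ (Wc : Scheme.{u}) (j : ↑W₂ ⟶ Wc) (h : Wc ⟶ S),
        IsOpenImmersion j ∧ IsProper h ∧ j ≫ h = W₂.ι ≫ f) →
      ∃ (Wc : Scheme.{u}) (j : ↑W ⟶ Wc) (h : Wc ⟶ S),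
        IsOpenImmersion j ∧ IsProper h ∧ j ≫ h = W.ι ≫ f)
    {B : Type u} [CommRing B] {Y : Scheme.{u}} (g : Y ⟶ Spec (.of B)) [IsSeparated g]
    [LocallyOfFiniteType g] [QuasiCompact g] :
    ∃ (Yc : Scheme.{u}) (j : Y ⟶ Yc) (h : Yc ⟶ Spec (.of B)),
      IsOpenImmersion j ∧ IsProper h ∧ j ≫ h = g := by
  obtain ⟨A₀, _, φ, Y₀, p, j, hA₀, -, -, hp₁, hp₂, hp₃, hj, hjg⟩ :=
    Literature.AlgebraicGeometry.Limits.exists_finiteTypeModel g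
  haveI := hp₁
  haveI := hp₂
  haveI := hp₃
  haveI := hj
  -- `Spec A₀` and `Y₀` are Noetherian: `A₀` is, and `Y₀` is of finite type over it
  haveI : IsNoetherianRing (CommRingCat.of A₀) := hA₀
  haveI : IsNoetherian (Spec (CommRingCat.of A₀)) := { }
  haveI : IsLocallyNoetherian Y₀ := LocallyOfFiniteType.isLocallyNoetherian p
  haveI : CompactSpace Y₀ := QuasiCompact.compactSpace_of_compactSpace p
  haveI : IsNoetherian Y₀ := { }
  -- compactify `Y₀ → Spec A₀`
  obtain hY₀ := exists_compactification_of_isNoetherian_of_twoPiece p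
    (fun U hU => by haveI : IsAffine U := hU; exact hAff (U.ι ≫ p)) (h0F40 p)
  -- base change to `Spec B`, then the closed immersion `Y ↪ Y₀ ×_{A₀} Spec B`
  obtain ⟨Zc, j', h', hj', hh', hfac⟩ :=
    exists_compactification_pullback_snd p (Spec.map (CommRingCat.ofHom φ)) hY₀
  haveI := hj'
  haveI := hh'
  haveI : QuasiCompact (j' ≫ h') := hfac ▸ inferInstance
  haveI : QuasiCompact j' := .of_comp j' h'
  obtain ⟨Yc, k, h, hk, hh, hkh⟩ := exists_compactification_of_immersion (j ≫ j') h'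
  exact ⟨Yc, k, h, hk, hh, by rw [hkh, Category.assoc, hfac, hjg]⟩

/-- **Nagata's compactification theorem (Conrad 2007, Thm. 4.1; Stacks 0F41) from Raynaud–Gruson
flattening by blowing up (`Stacks081R`, Stacks 081R = Raynaud–Gruson 1971, Thm. 5.2.2).** Every
separated morphism of finite type `f : X → S` to a quasi-compact quasi-separated scheme factors
as an open immersion followed by a proper morphism — granted `Stacks081R`, the only undischarged
input (see the module docstring for the architecture of the proof).
[cite: Conrad2007, Thm. 4.1; StacksProject, Tag 0F41] -/
theorem NagataCompactification.of_stacks081R (h081R : Stacks081R.{u}) :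
    NagataCompactification.{u} := by
  intro X S f _ _ _ _ _
  refine exists_compactification_of_forall_affineOpens h081R f fun U => ?_
  haveI : IsAffine (U : S.Opens) := U.2
  -- over the affine `U ≅ Spec Γ(U)`
  obtain ⟨Y, j, q, hj, hq, hjq⟩ := exists_compactification_affineBase_of_twoPiece_noetherian
    (fun S U _ g _ _ => exists_compactification_of_isAffine g)
    (by
      intro S X _ _ _ f _ _ W W₁ W₂ hW hd h₁ h₂
      exact h0F40_of_stacks081R h081R f W W₁ W₂ hW hd h₁ h₂)
    ((f ∣_ (U : S.Opens)) ≫ (Scheme.isoSpec (U : S.Opens)).hom)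
  haveI := hq
  exact ⟨Y, j, q ≫ (Scheme.isoSpec (U : S.Opens)).inv, hj, inferInstance, by
    rw [reassoc_of% hjq, Iso.hom_inv_id, Category.comp_id]⟩

end Literature.AlgebraicGeometry.Morphisms

end
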